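import Summits.ABC.IUTFork.Conditional.WRowLicenceTripleSocketMLocalTypeSlot
import Summits.ABC.IUTFork.Conditional.WRowLicenceTripleSocketMSlotLevel
import Summits.ABC.IUTFork.Conditional.WRowFrey73NineteenInhabitedHalf
import Summits.ABC.IUTFork.Conditional.RefBandsInhTypeLevelsBand1025227
import Summits.ABC.IUTFork.Conditional.WRowHexLamSevenSevenFortyOne
import HarnessLib

/-!
# Branch C / R-W, reading (U), M line: M-SETTING twins of K-line INH theorems under a MODEL CLAUSE / LOCAL TYPE / single-level shape — batch B
# (abc-iut cell, branch C, row «C:INH-M-TWIN-RESIDUE» item (e), standing duty; seat abc-iut-C-cert-2 gen 8; C LEAD KEY 2026-08-27T13:11Z)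

Record-only PROOF file (D-0012; 0 definitions, 0 `Prop` facts, nothing re-typed) of the abc-iut cell. TAKES NO SIDE on [IUTchIII] Cor. 3.12
(S. Mochizuki, *Inter-universal Teichmüller theory III*, Cor. 3.12 p. 173–174; Step (xi-f) p. 184) or on any author; «inhabited as typed» ≠
«asserted in print».

Each K theorem below is a ≤ 6-line application («wrapper») of a K socket / K theorem that already has an M twin in the tree (this seat's
`WRowM.licence_triple_slot_of_localType` p529891, `WRowM.licence_triple_unconditional_slot_level` (gen 8), …) — so its M twin repeats the SAME
lines with the M names: SAME certificate BY NAME (no number re-derived), SAME envelope exponents, SAME `j ≠ 1728` discharge, SAME model-clause /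
local-type discharge (`IsSquare`, `e(·|p) = 30·l`, …) VERBATIM on the K side; conclusion = `Thm311ToCor312.Licence` at the M-LEVEL setting of the
datum's own ideles `settingPrVolSharpM T.D hlog (tOfIdeleData T.D r) (tqM … r …) …` (every idele datum `r`, every analytic `logvK`, any
`htq0/Sq/htq1`), whose (U) binder therefore reads INHABITED AS TYPED where the K theorem says (under the same clause).

THIS FILE (4 theorems): `WRowM.licence_frey73_nineteen_of_localType30_M` (K `WRow.licence_frey73_nineteen_of_localType30`, `WRowFrey73NineteenInhabitedHalf`) · `WRowM.licence_frey73_nineteen_of_isSquare_M` (K `WRow.licence_frey73_nineteen_of_isSquare`, `WRowFrey73NineteenInhabitedHalf`) · `WRowM.licence_triple_1025227_typelevels_e10_M` (K `WRow.licence_triple_1025227_typelevels_e10`, `RefBandsInhTypeLevelsBand1025227`) · `WRowM.licence_lamSeven_seven_fortyOne_M` (K `WRow.licence_lamSeven_seven_fortyOne`, `WRowHexLamSevenSevenFortyOne`)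

HONEST SCOPE: OUR sharp containers and Dupuy–Hilado's typed (Ind1)/(Ind2); STRONGER-THAN-PRINT hull reading; a socket discharges nothing;
statements under a model clause stay under it; non-emptiness of the datum type, admissibility and Szpiro-badness NOT claimed; explicit hypothesis
counts of the record books UNCHANGED; an M twin changes NO K-line census count; nothing about the printed GLOBAL inequality or the number-level
corollary; typed ≠ proved; instantiated ≠ endorsed; no abc claim. [cite: Mochizuki2012, IUTchI Def. 3.1 (b),(c) pp. 61–62, Ex. 3.2 (iv) p. 71;
IUTchIII Cor. 3.12 Step (xi-f) p. 184; IUTchIV Thm. 1.10 p. 22, Prop. 1.2 (i)(ii) p. 10, Prop. 1.4 (ii) p. 13, Cor. 2.2 (ii) proof (P5) p. 46]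
[cite: DupuyHilado2025, §3.3, §3.4, §4.9, §4.12] [claim: Mochizuki2012, status: disputed] for every IUT sentence. PROOF-ONLY: no definitions.
-/

noncomputable section

open Set Function Metric NumberField IsDedekindDomain

namespace Summit.ABC.IUTFork.Conditional

open Thm311 Thm311.Real Cor312 Cor312Vol Cor312Prov Literature.IUT.LogThetaLattice Literature.IUT.LogVolume
  Literature.IUT.HodgeTheaters Literature.IUT.LogVolume.Cor22
open Literature.NumberTheory.NumberFields Literature.NumberTheory.GaloisRepresentations.Ultrametric
open Literature.NumberTheory.DiophantineGeometry Literature.NumberTheory.DiophantineGeometry.GenEll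

/-- **M TWIN of `WRow.licence_frey73_nineteen_of_localType30`** (`WRowFrey73NineteenInhabitedHalf`; binders `—` VERBATIM, incl. any model-clause / local-type hypothesis): for EVERY genuine Θ-volume datum `T`
there and EVERY idele datum `r` of `T.D`, `Thm311ToCor312.Licence` at `settingPrVolSharpM T.D hlog (tOfIdeleData T.D r) (tqM … r …) …` — «wrapper» over `WRowM.licence_triple_slot_of_localType`,
K certificates and discharges BY NAME. The M books' (U) binder is INHABITED AS TYPED there. [cite: Mochizuki2012, IUTchIII Cor. 3.12 Step (xi-f) p. 184;
IUTchIV Prop. 1.2 (i)(ii) p. 10, Cor. 2.2 (ii) proof (P5) p. 46] [cite: DupuyHilado2025, §3.3, §3.4, §4.9, §4.12] [claim: Mochizuki2012, status: disputed] -/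
theorem WRowM.licence_frey73_nineteen_of_localType30_M (T : Cor22.ThetaVolumeDatumAt (ratPoint (((73 : ℕ) : ℚ) / (5973865915867209 : ℕ))) 19)
    (hloc : letI := T.instFieldF; letI := T.instNumberFieldF; letI := T.instAlgebraF; letI := T.instFieldK
      letI := T.instNumberFieldK; letI := T.instAlgebraK; letI := T.instFieldFbar; letI := T.instAlgebraFbar
      letI := T.instAlgebraKFbar; letI := T.instIsElliptic
      haveI : Fact (Nat.Prime 7) := ⟨by norm_num⟩
      ∀ x₀ : (thetaIndex (pilotDataOfK T.D T.K)).Fibre (.inr ⟨7, by norm_num⟩),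
        absRamificationIdx 7 (kOf (pilotDataOfK T.D T.K) 7 x₀) = 570) :
    letI := T.instFieldF; letI := T.instNumberFieldF; letI := T.instAlgebraF; letI := T.instFieldK
    letI := T.instNumberFieldK; letI := T.instAlgebraK; letI := T.instFieldFbar; letI := T.instAlgebraFbar
    letI := T.instAlgebraKFbar; letI := T.instIsElliptic
    ∀ {logvK : PadicLogsVal T.K} (hlog : LogvAnalyticVal logvK) (r : ThetaData.IdeleData T.D) (M : Type) [Field M] [NumberField M]
      (archPk : ∀ (j : (thetaIndexOfInitial T.D).Label) (vQ : (thetaIndexOfInitial T.D).VQ),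
        Set ((logShellsOfInitialDH T.D logvK).Packet j vQ))
      (archSub : ∀ (j : (thetaIndexOfInitial T.D).Label) (v : (thetaIndexOfInitial T.D).V),
        Set ((logShellsOfInitialDH T.D logvK).Packet j ((thetaIndexOfInitial T.D).over v)))
      (Ψ : ℤ → ∀ v : (thetaIndexOfInitial T.D).V, v ∈ (thetaIndexOfInitial T.D).Vbad →
        Set ((logShellsOfInitialDH T.D logvK).StarPacket v))
      (act : ℤ → ∀ v : (thetaIndexOfInitial T.D).V, v ∈ (thetaIndexOfInitial T.D).Vbad →
        (logShellsOfInitialDH T.D logvK).StarPacket v → Module.End ℚ ((logShellsOfInitialDH T.D logvK).StarPacket v))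
      (Mmod : ℤ → ∀ j : (thetaIndexOfInitial T.D).LabelStar, Set ((logShellsOfInitialDH T.D logvK).GlobalPacket j.1))
      (region : ℤ → ∀ j : (thetaIndexOfInitial T.D).LabelStar, FinDivisor M → ∀ vQ : (thetaIndexOfInitial T.D).VQ,
        Set ((logShellsOfInitialDH T.D logvK).Packet j.1 vQ))
      (n : ℤ) {HT : Type} {LogLink : HT → HT → Type} {IsFull : ∀ {s t : HT}, LogLink s t → Prop}
      (lat : LGPGaussianLogThetaLattice LogLink IsFull)
      {Frd : Type} {IsoF : Frd → Frd → Type} {Ob : Frd → Type} {realify : Frd → Frd} {Strip : Type}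
      {IsoS : Strip → Strip → Type}
      {Mv : ∀ v : (thetaIndexOfInitial T.D).V, v ∈ (thetaIndexOfInitial T.D).Vbad → Type} [∀ v h, Monoid (Mv v h)]
      (sig : GlobalLGPFrobenioidSignature (thetaIndexOfInitial T.D).lstar (thetaIndexOfInitial T.D).V
        (· ∈ (thetaIndexOfInitial T.D).Vbad) Frd IsoF Ob realify Strip IsoS Mv)
      (split : SplittingMonoids Mv) {ObΔ : Type}
      {N : ∀ v : (thetaIndexOfInitial T.D).V, v ∈ (thetaIndexOfInitial T.D).Vbad → Type} [∀ v h, Monoid (N v h)]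
      (qData : QPilotData ObΔ N)
      (htq0 : ∀ (u : FinitePlace ℚ) (x : (thetaIndexOfInitial T.D).Fibre (Val.non u)),
        tqM T.D (ratChar u) u (natCast_ratChar_mem u) r x ≠ 0)
      (Sq : Finset (FinitePlace ℚ))
      (htq1 : ∀ (u : FinitePlace ℚ) (x : (thetaIndexOfInitial T.D).Fibre (Val.non u)), u ∉ Sq →
        ‖tqM T.D (ratChar u) u (natCast_ratChar_mem u) r x‖ = 1),
      Thm311ToCor312.Licence
        (settingPrVolSharpM T.D hlog (tOfIdeleData T.D r) (fun u x => tqM T.D (ratChar u) u (natCast_ratChar_mem u) r x) M archPk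
          archSub Ψ act Mmod region n lat sig split qData htq0 Sq htq1) :=
  WRowM.licence_triple_slot_of_localType isABCTriple_frey73 (by rw [Cor22.jInv_ratPoint_triple isABCTriple_frey73]; norm_num) T
    (fun p => if p = 3 then 5 else if p = 7 then 3 else if p = 103 then 1 else 0)
    (fun p => if p = 3 then 6 else if p = 7 then 4 else if p = 103 then 2 else 1) (fun p e => p = 7 → e = 570)
    (by
      intro pp x _ hpp
      obtain rfl : pp = ⟨7, by norm_num⟩ := Subtype.ext hpp
      exact hloc x) WRow.hcell_frey73_nineteen_localType30

/-- **M TWIN of `WRow.licence_frey73_nineteen_of_isSquare`** (`WRowFrey73NineteenInhabitedHalf`; binders `—` VERBATIM, incl. any model-clause / local-type hypothesis): for EVERY genuine Θ-volume datum `T`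
there and EVERY idele datum `r` of `T.D`, `Thm311ToCor312.Licence` at `settingPrVolSharpM T.D hlog (tOfIdeleData T.D r) (tqM … r …) …` — «wrapper» over the M twins of this file,
K certificates and discharges BY NAME. The M books' (U) binder is INHABITED AS TYPED there. [cite: Mochizuki2012, IUTchIII Cor. 3.12 Step (xi-f) p. 184;
IUTchIV Prop. 1.2 (i)(ii) p. 10, Cor. 2.2 (ii) proof (P5) p. 46] [cite: DupuyHilado2025, §3.3, §3.4, §4.9, §4.12] [claim: Mochizuki2012, status: disputed] -/
theorem WRowM.licence_frey73_nineteen_of_isSquare_M (T : Cor22.ThetaVolumeDatumAt (ratPoint (((73 : ℕ) : ℚ) / (5973865915867209 : ℕ))) 19)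
    (hsq : letI := T.instFieldF; letI := T.instAlgebraF
      IsSquare (algebraMap (ratPoint (((73 : ℕ) : ℚ) / (5973865915867209 : ℕ))).F T.F ((((73 : ℕ) : ℚ) / (5973865915867209 : ℕ) - 1 : ℚ)))) :
    letI := T.instFieldF; letI := T.instNumberFieldF; letI := T.instAlgebraF; letI := T.instFieldK
    letI := T.instNumberFieldK; letI := T.instAlgebraK; letI := T.instFieldFbar; letI := T.instAlgebraFbar
    letI := T.instAlgebraKFbar; letI := T.instIsElliptic
    ∀ {logvK : PadicLogsVal T.K} (hlog : LogvAnalyticVal logvK) (r : ThetaData.IdeleData T.D) (M : Type) [Field M] [NumberField M]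
      (archPk : ∀ (j : (thetaIndexOfInitial T.D).Label) (vQ : (thetaIndexOfInitial T.D).VQ),
        Set ((logShellsOfInitialDH T.D logvK).Packet j vQ))
      (archSub : ∀ (j : (thetaIndexOfInitial T.D).Label) (v : (thetaIndexOfInitial T.D).V),
        Set ((logShellsOfInitialDH T.D logvK).Packet j ((thetaIndexOfInitial T.D).over v)))
      (Ψ : ℤ → ∀ v : (thetaIndexOfInitial T.D).V, v ∈ (thetaIndexOfInitial T.D).Vbad →
        Set ((logShellsOfInitialDH T.D logvK).StarPacket v))
      (act : ℤ → ∀ v : (thetaIndexOfInitial T.D).V, v ∈ (thetaIndexOfInitial T.D).Vbad →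
        (logShellsOfInitialDH T.D logvK).StarPacket v → Module.End ℚ ((logShellsOfInitialDH T.D logvK).StarPacket v))
      (Mmod : ℤ → ∀ j : (thetaIndexOfInitial T.D).LabelStar, Set ((logShellsOfInitialDH T.D logvK).GlobalPacket j.1))
      (region : ℤ → ∀ j : (thetaIndexOfInitial T.D).LabelStar, FinDivisor M → ∀ vQ : (thetaIndexOfInitial T.D).VQ,
        Set ((logShellsOfInitialDH T.D logvK).Packet j.1 vQ))
      (n : ℤ) {HT : Type} {LogLink : HT → HT → Type} {IsFull : ∀ {s t : HT}, LogLink s t → Prop}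
      (lat : LGPGaussianLogThetaLattice LogLink IsFull)
      {Frd : Type} {IsoF : Frd → Frd → Type} {Ob : Frd → Type} {realify : Frd → Frd} {Strip : Type}
      {IsoS : Strip → Strip → Type}
      {Mv : ∀ v : (thetaIndexOfInitial T.D).V, v ∈ (thetaIndexOfInitial T.D).Vbad → Type} [∀ v h, Monoid (Mv v h)]
      (sig : GlobalLGPFrobenioidSignature (thetaIndexOfInitial T.D).lstar (thetaIndexOfInitial T.D).V
        (· ∈ (thetaIndexOfInitial T.D).Vbad) Frd IsoF Ob realify Strip IsoS Mv)
      (split : SplittingMonoids Mv) {ObΔ : Type}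
      {N : ∀ v : (thetaIndexOfInitial T.D).V, v ∈ (thetaIndexOfInitial T.D).Vbad → Type} [∀ v h, Monoid (N v h)]
      (qData : QPilotData ObΔ N)
      (htq0 : ∀ (u : FinitePlace ℚ) (x : (thetaIndexOfInitial T.D).Fibre (Val.non u)),
        tqM T.D (ratChar u) u (natCast_ratChar_mem u) r x ≠ 0)
      (Sq : Finset (FinitePlace ℚ))
      (htq1 : ∀ (u : FinitePlace ℚ) (x : (thetaIndexOfInitial T.D).Fibre (Val.non u)), u ∉ Sq →
        ‖tqM T.D (ratChar u) u (natCast_ratChar_mem u) r x‖ = 1),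
      Thm311ToCor312.Licence
        (settingPrVolSharpM T.D hlog (tOfIdeleData T.D r) (fun u x => tqM T.D (ratChar u) u (natCast_ratChar_mem u) r x) M archPk
          archSub Ψ act Mmod region n lat sig split qData htq0 Sq htq1) := by
  refine WRowM.licence_frey73_nineteen_of_localType30_M T fun x₀ => ?_
  have hpole : ∀ v : HeightOneSpectrum (𝓞 ℚ), Rat.HeightOneSpectrum.natGenerator v = ((⟨7, by norm_num⟩ : Nat.Primes) : ℕ) →
      ord ℚ v (jInv (((73 : ℕ) : ℚ) / (5973865915867209 : ℕ))) = -(2 * ((7 : ℕ) : ℤ)) := by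
    intro v hv
    rw [WRow.ord_jInv_frey73 v hv (Or.inr (Or.inl rfl))]
    norm_num
  -- `ord_7(λ − 1) = 7` is ODD (the K file's private lemma `ord_seven_lam_sub_one`, re-derived inline: `λ − 1 = −2¹³7⁷941²/(3¹⁶103³127)`)
  have hodd7 : ∀ v : HeightOneSpectrum (𝓞 ℚ), Rat.HeightOneSpectrum.natGenerator v = ((⟨7, by norm_num⟩ : Nat.Primes) : ℕ) →
      Odd (ord ℚ v ((((73 : ℕ) : ℚ) / (5973865915867209 : ℕ)) - 1)) := by
    intro v hv
    have hq0 : ((((73 : ℕ) : ℚ) / (5973865915867209 : ℕ)) - 1) ≠ 0 := by norm_num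
    have hb : padicValNat 7 5973865915867136 = 7 := by
      have h : (5973865915867136 : ℕ) = 7 ^ 7 * 7253860352 := by norm_num
      rw [h, padicValNat.mul (by norm_num) (by norm_num), padicValNat.prime_pow, padicValNat.eq_zero_of_not_dvd (by norm_num)]
    have hc : padicValNat 7 5973865915867209 = 0 := padicValNat.eq_zero_of_not_dvd (by norm_num)
    rw [GenuineK.ord_rat_eq_padicValRat v hq0, hv]
    rw [show ((((73 : ℕ) : ℚ) / (5973865915867209 : ℕ)) - 1) = -(((5973865915867136 : ℕ) : ℚ) / ((5973865915867209 : ℕ) : ℚ)) by norm_num,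
      padicValRat.neg, padicValRat.div (by norm_num) (by norm_num), padicValRat.of_nat, padicValRat.of_nat]
    simp only [hb, hc]
    decide
  have h := GenuineK.absRamificationIdx_kOf_eq_thirty_mul_of_isSquare T ⟨7, by norm_num⟩ (by norm_num) (by norm_num) (by norm_num) (by norm_num)
    (by norm_num) hpole (by norm_num) hsq hodd7 x₀
  norm_num at h
  exact h

/-- **M TWIN of `WRow.licence_triple_1025227_typelevels_e10`** (`RefBandsInhTypeLevelsBand1025227`; binders `{l : ℕ} (hl : l.Prime) (hL : l ∈ ([839] : List ℕ))` VERBATIM, incl. any model-clause / local-type hypothesis): for EVERY genuine Θ-volume datum `T`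
there and EVERY idele datum `r` of `T.D`, `Thm311ToCor312.Licence` at `settingPrVolSharpM T.D hlog (tOfIdeleData T.D r) (tqM … r …) …` — «wrapper» over `WRowM.licence_triple_slot_of_localType`,
K certificates and discharges BY NAME. The M books' (U) binder is INHABITED AS TYPED there. [cite: Mochizuki2012, IUTchIII Cor. 3.12 Step (xi-f) p. 184;
IUTchIV Prop. 1.2 (i)(ii) p. 10, Cor. 2.2 (ii) proof (P5) p. 46] [cite: DupuyHilado2025, §3.3, §3.4, §4.9, §4.12] [claim: Mochizuki2012, status: disputed] -/
theorem WRowM.licence_triple_1025227_typelevels_e10_M {l : ℕ} (hl : l.Prime) (hL : l ∈ ([839] : List ℕ))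
    (T : Cor22.ThetaVolumeDatumAt (ratPoint (((7 ^ 5 * 61 : ℕ) : ℚ) / (3 ^ 13 * 5 ^ 8 * 11 ^ 3 * 53 * 73 ^ 2 * 89 ^ 2 * 103 : ℕ))) l)
    (hloc : letI := T.instFieldF; letI := T.instNumberFieldF; letI := T.instAlgebraF; letI := T.instFieldK
      letI := T.instNumberFieldK; letI := T.instAlgebraK; letI := T.instFieldFbar; letI := T.instAlgebraFbar
      letI := T.instAlgebraKFbar; letI := T.instIsElliptic
      haveI : Fact (Nat.Prime 4229) := ⟨by norm_num⟩
      ∀ x₀ : (thetaIndex (pilotDataOfK T.D T.K)).Fibre (.inr ⟨4229, by norm_num⟩),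
        absRamificationIdx 4229 (kOf (pilotDataOfK T.D T.K) 4229 x₀) = 10 * l) :
    letI := T.instFieldF; letI := T.instNumberFieldF; letI := T.instAlgebraF; letI := T.instFieldK
    letI := T.instNumberFieldK; letI := T.instAlgebraK; letI := T.instFieldFbar; letI := T.instAlgebraFbar
    letI := T.instAlgebraKFbar; letI := T.instIsElliptic
    ∀ {logvK : PadicLogsVal T.K} (hlog : LogvAnalyticVal logvK) (r : ThetaData.IdeleData T.D) (M : Type) [Field M] [NumberField M]
      (archPk : ∀ (j : (thetaIndexOfInitial T.D).Label) (vQ : (thetaIndexOfInitial T.D).VQ),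
        Set ((logShellsOfInitialDH T.D logvK).Packet j vQ))
      (archSub : ∀ (j : (thetaIndexOfInitial T.D).Label) (v : (thetaIndexOfInitial T.D).V),
        Set ((logShellsOfInitialDH T.D logvK).Packet j ((thetaIndexOfInitial T.D).over v)))
      (Ψ : ℤ → ∀ v : (thetaIndexOfInitial T.D).V, v ∈ (thetaIndexOfInitial T.D).Vbad →
        Set ((logShellsOfInitialDH T.D logvK).StarPacket v))
      (act : ℤ → ∀ v : (thetaIndexOfInitial T.D).V, v ∈ (thetaIndexOfInitial T.D).Vbad →
        (logShellsOfInitialDH T.D logvK).StarPacket v → Module.End ℚ ((logShellsOfInitialDH T.D logvK).StarPacket v))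
      (Mmod : ℤ → ∀ j : (thetaIndexOfInitial T.D).LabelStar, Set ((logShellsOfInitialDH T.D logvK).GlobalPacket j.1))
      (region : ℤ → ∀ j : (thetaIndexOfInitial T.D).LabelStar, FinDivisor M → ∀ vQ : (thetaIndexOfInitial T.D).VQ,
        Set ((logShellsOfInitialDH T.D logvK).Packet j.1 vQ))
      (n : ℤ) {HT : Type} {LogLink : HT → HT → Type} {IsFull : ∀ {s t : HT}, LogLink s t → Prop}
      (lat : LGPGaussianLogThetaLattice LogLink IsFull)
      {Frd : Type} {IsoF : Frd → Frd → Type} {Ob : Frd → Type} {realify : Frd → Frd} {Strip : Type}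
      {IsoS : Strip → Strip → Type}
      {Mv : ∀ v : (thetaIndexOfInitial T.D).V, v ∈ (thetaIndexOfInitial T.D).Vbad → Type} [∀ v h, Monoid (Mv v h)]
      (sig : GlobalLGPFrobenioidSignature (thetaIndexOfInitial T.D).lstar (thetaIndexOfInitial T.D).V
        (· ∈ (thetaIndexOfInitial T.D).Vbad) Frd IsoF Ob realify Strip IsoS Mv)
      (split : SplittingMonoids Mv) {ObΔ : Type}
      {N : ∀ v : (thetaIndexOfInitial T.D).V, v ∈ (thetaIndexOfInitial T.D).Vbad → Type} [∀ v h, Monoid (N v h)]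
      (qData : QPilotData ObΔ N)
      (htq0 : ∀ (u : FinitePlace ℚ) (x : (thetaIndexOfInitial T.D).Fibre (Val.non u)),
        tqM T.D (ratChar u) u (natCast_ratChar_mem u) r x ≠ 0)
      (Sq : Finset (FinitePlace ℚ))
      (htq1 : ∀ (u : FinitePlace ℚ) (x : (thetaIndexOfInitial T.D).Fibre (Val.non u)), u ∉ Sq →
        ‖tqM T.D (ratChar u) u (natCast_ratChar_mem u) r x‖ = 1),
      Thm311ToCor312.Licence
        (settingPrVolSharpM T.D hlog (tOfIdeleData T.D r) (fun u x => tqM T.D (ratChar u) u (natCast_ratChar_mem u) r x) M archPk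
          archSub Ψ act Mmod region n lat sig split qData htq0 Sq htq1) :=
  WRowM.licence_triple_slot_of_localType isABCTriple_4229 (by rw [Cor22.jInv_ratPoint_triple isABCTriple_4229]; norm_num) T
    (fun p => if p = 3 then 4 else if p = 5 then 2 else if p = 7 then 2 else if p = 11 then 1 else if p = 13 then 3 else if p = 17 then 1 else if p = 53 then 0 else if p = 61 then 0 else if p = 73 then 0 else if p = 89 then 0 else if p = 103 then 0 else if p = 4229 then 1 else 0) (fun p => if p = 3 then 4 else if p = 5 then 2 else if p = 7 then 2 else if p = 11 then 1 else if p = 13 then 3 else if p = 17 then 1 else if p = 53 then 0 else if p = 61 then 0 else if p = 73 then 0 else if p = 89 then 0 else if p = 103 then 0 else if p = 4229 then 1 else 0) (fun p e => (4229 = p → e = 10 * l))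
    (by
      intro pp x _ hpp
      obtain rfl : pp = ⟨4229, by norm_num⟩ := Subtype.ext hpp.symm
      exact hloc x) (RefBand.inhcell_1025227_type_levels hl hL)

/-- **M TWIN of `WRow.licence_lamSeven_seven_fortyOne`** (`WRowHexLamSevenSevenFortyOne`; binders `{k l : ℕ} (hk : k = 7) (hl : l = 41)` VERBATIM, incl. any model-clause / local-type hypothesis): for EVERY genuine Θ-volume datum `T`
there and EVERY idele datum `r` of `T.D`, `Thm311ToCor312.Licence` at `settingPrVolSharpM T.D hlog (tOfIdeleData T.D r) (tqM … r …) …` — «wrapper» over `WRowM.licence_triple_unconditional_slot_level`,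
K certificates and discharges BY NAME. The M books' (U) binder is INHABITED AS TYPED there. [cite: Mochizuki2012, IUTchIII Cor. 3.12 Step (xi-f) p. 184;
IUTchIV Prop. 1.2 (i)(ii) p. 10, Cor. 2.2 (ii) proof (P5) p. 46] [cite: DupuyHilado2025, §3.3, §3.4, §4.9, §4.12] [claim: Mochizuki2012, status: disputed] -/
theorem WRowM.licence_lamSeven_seven_fortyOne_M {k l : ℕ} (hk : k = 7) (hl : l = 41) (T : Cor22.ThetaVolumeDatumAt (ratPoint ((2 : ℚ)⁻¹ + 2 / 7 ^ k)) l) :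
    letI := T.instFieldF; letI := T.instNumberFieldF; letI := T.instAlgebraF; letI := T.instFieldK
    letI := T.instNumberFieldK; letI := T.instAlgebraK; letI := T.instFieldFbar; letI := T.instAlgebraFbar
    letI := T.instAlgebraKFbar; letI := T.instIsElliptic
    ∀ {logvK : PadicLogsVal T.K} (hlog : LogvAnalyticVal logvK) (r : ThetaData.IdeleData T.D) (M : Type) [Field M] [NumberField M]
      (archPk : ∀ (j : (thetaIndexOfInitial T.D).Label) (vQ : (thetaIndexOfInitial T.D).VQ),
        Set ((logShellsOfInitialDH T.D logvK).Packet j vQ))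
      (archSub : ∀ (j : (thetaIndexOfInitial T.D).Label) (v : (thetaIndexOfInitial T.D).V),
        Set ((logShellsOfInitialDH T.D logvK).Packet j ((thetaIndexOfInitial T.D).over v)))
      (Ψ : ℤ → ∀ v : (thetaIndexOfInitial T.D).V, v ∈ (thetaIndexOfInitial T.D).Vbad →
        Set ((logShellsOfInitialDH T.D logvK).StarPacket v))
      (act : ℤ → ∀ v : (thetaIndexOfInitial T.D).V, v ∈ (thetaIndexOfInitial T.D).Vbad →
        (logShellsOfInitialDH T.D logvK).StarPacket v → Module.End ℚ ((logShellsOfInitialDH T.D logvK).StarPacket v))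
      (Mmod : ℤ → ∀ j : (thetaIndexOfInitial T.D).LabelStar, Set ((logShellsOfInitialDH T.D logvK).GlobalPacket j.1))
      (region : ℤ → ∀ j : (thetaIndexOfInitial T.D).LabelStar, FinDivisor M → ∀ vQ : (thetaIndexOfInitial T.D).VQ,
        Set ((logShellsOfInitialDH T.D logvK).Packet j.1 vQ))
      (n : ℤ) {HT : Type} {LogLink : HT → HT → Type} {IsFull : ∀ {s t : HT}, LogLink s t → Prop}
      (lat : LGPGaussianLogThetaLattice LogLink IsFull)
      {Frd : Type} {IsoF : Frd → Frd → Type} {Ob : Frd → Type} {realify : Frd → Frd} {Strip : Type}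
      {IsoS : Strip → Strip → Type}
      {Mv : ∀ v : (thetaIndexOfInitial T.D).V, v ∈ (thetaIndexOfInitial T.D).Vbad → Type} [∀ v h, Monoid (Mv v h)]
      (sig : GlobalLGPFrobenioidSignature (thetaIndexOfInitial T.D).lstar (thetaIndexOfInitial T.D).V
        (· ∈ (thetaIndexOfInitial T.D).Vbad) Frd IsoF Ob realify Strip IsoS Mv)
      (split : SplittingMonoids Mv) {ObΔ : Type}
      {N : ∀ v : (thetaIndexOfInitial T.D).V, v ∈ (thetaIndexOfInitial T.D).Vbad → Type} [∀ v h, Monoid (N v h)]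
      (qData : QPilotData ObΔ N)
      (htq0 : ∀ (u : FinitePlace ℚ) (x : (thetaIndexOfInitial T.D).Fibre (Val.non u)),
        tqM T.D (ratChar u) u (natCast_ratChar_mem u) r x ≠ 0)
      (Sq : Finset (FinitePlace ℚ))
      (htq1 : ∀ (u : FinitePlace ℚ) (x : (thetaIndexOfInitial T.D).Fibre (Val.non u)), u ∉ Sq →
        ‖tqM T.D (ratChar u) u (natCast_ratChar_mem u) r x‖ = 1),
      Thm311ToCor312.Licence
        (settingPrVolSharpM T.D hlog (tOfIdeleData T.D r) (fun u x => tqM T.D (ratChar u) u (natCast_ratChar_mem u) r x) M archPk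
          archSub Ψ act Mmod region n lat sig split qData htq0 Sq htq1) := by
  subst hk hl
  revert T
  rw [lamSeven_eq_hex7]
  intro T
  exact WRowM.licence_triple_unconditional_slot_level isABCTriple_hex7 (by rw [Cor22.jInv_ratPoint_triple isABCTriple_hex7]; norm_num) T
    (fun p => if p = 7 then 3 else 0) (fun p => if p = 7 then 4 else 1) WRow.hcell_lamSeven_seven_fortyOne

end Summit.ABC.IUTFork.Conditional

end
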